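import Literature.AlgebraicGeometry.HodgeTheory.KunnethComponentsOfPushPullClasses
import Literature.AlgebraicGeometry.HodgeTheory.AlgebraicClassesGysinOneSpan
import HarnessLib

/-!
# The Künneth components of an algebraic class whose cycle is dominated by varieties satisfying `C`;
# unconditionally for cycles of dimension `≤ 2` (e.g. all algebraic classes in `H⁴(S × S')`)

Family `hodge`, layer `Literature/AlgebraicGeometry/HodgeTheory`; namespace
`Literature.AlgebraicGeometry.HodgeTheory`. Theorems only (no definition, no named fact, sorry-free).

Kleiman / Kahn (Def. 6.29, Lemma 6.30): under the Künneth standard conjecture the Künneth components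
`γ = Σ γ_{(2e−i, i)}` of an ALGEBRAIC class `γ ∈ H^{2e}((W ⊗ X)(ℂ); ℂ)` are algebraic — classically via
`γ_{(2e−i,i)} = p_W ∘ γ ∘ p^i_X` and the composition of correspondences (Chow's moving lemma). On the
tree's carriers the composition-free route: an algebraic class of codimension `e` on `W ⊗ X` is a
`ℂ`-linear combination of Gysin images `h_* 1_V` of smooth projective `d`-folds `h : V ⟶ W ⊗ X`,
`d + e = dim W + dim X` (the tree's `algebraicClasses_eq_span_complexGysin_one`: Deligne Hodge III
Cor. 8.2.8 + Hironaka, both theorems of the tree); `h_* 1_V = (h ≫ pr_W, h ≫ pr_X)_* 1_V` is a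
push–pull class, whose Künneth components are algebraic as soon as `C(V)` holds and `dim W ≤ d`
(`kunnethComponent_pushPullClass_mem_algebraicClasses_of_forall`); and Künneth components depend
linearly on the class (uniqueness, `eq_of_sum_kunnethPiece_eq`). Hence:

* §1 **`kunnethComponent_mem_algebraicClasses_of_forall_source`** — if `C(V)` holds for every smooth
  projective `V` of dimension `d = dim W + dim X − e ≥ dim W`, then every Künneth component of every
  algebraic class `γ ∈ Nᵉ H^{2e}((W ⊗ X)(ℂ))` is algebraic.
* §2 **UNCONDITIONAL CASES** (`C` holds in dimension `≤ 2`,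
  `kunnethComponent_diagonalClass_mem_algebraicClasses_of_le_two`): `…_of_le_two` (`d ≤ 2`), and the
  named instances **`kunnethComponent_mem_algebraicClasses_surfaces`** — EVERY ALGEBRAIC CLASS OF
  `H⁴((S ⊗ S')(ℂ); ℂ)` FOR SMOOTH PROJECTIVE SURFACES `S`, `S'` HAS ALGEBRAIC KÜNNETH COMPONENTS (the
  degree-`0` correspondences between surfaces) — `…_curves` (`H²(C ⊗ C')`), `…_curve_surface`
  (`H²`/`H⁴` of `C ⊗ S`), `…_surface_curve` (`H²(S ⊗ C)`).
* §3 Explicit families: `kunnethComponent_mem_algebraicClasses_of_mem_span` (the property "all Künneth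
  components of all Künneth decompositions are algebraic" is linear in the class),
  **`kunnethComponent_mem_algebraicClasses_of_eq_sum_complexGysin_one`** (a class
  `γ = Σ aⱼ (hⱼ)_* 1_{Vⱼ}` with `C(Vⱼ)` for every `j` has algebraic Künneth components), and
  `…_of_eq_sum_complexGysin_one_abelianVariety` (cycles dominated by abelian varieties: `C(A)` is the tree's
  `AbelianVariety.kunnethComponent_diagonalClass_mem_algebraicClasses`), and
  `…_of_eq_sum_complexGysin_one_tensor_of_le_two` (cycles dominated by products `P × Q` of varieties of
  dimension `≤ 2`, e.g. threefolds `C × S` and fourfolds `S × S'`: `C(P × Q)` is the tree's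
  `kunnethComponent_diagonalClass_mem_algebraicClasses_tensor_of_le_two`).

## References

* [Kahn2020] B. Kahn, Zeta and L-functions of varieties and motives, LMS LN 462, CUP 2020, §6.9
  Def. 6.29, Lemma 6.30, Thm. 6.31 (2).
* [Kleiman1968AlgebraicCycles] S. Kleiman, Algebraic cycles and the Weil conjectures (1968), §2.
* [Fulton1998] W. Fulton, Intersection Theory, 2nd ed., Springer 1998, §16.1 Prop. 16.1.1 (c),
  §19.1 Lemma 19.1.1.
* [Deligne2000] P. Deligne, The Hodge conjecture (Clay, 2000), §2 Remark (vi).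
* [Voisin2025] C. Voisin, Hodge and generalized Hodge conjectures, coniveau and algebraic cycles,
  J. Open Math. Probl. 1 (2025), §3.2.1 Cor. 3.9, (12)–(14).
-/

noncomputable section

open CategoryTheory AlgebraicGeometry MonoidalCategory CartesianMonoidalCategory Finset
open Literature.AlgebraicTopology.SingularHomology
open Literature.AlgebraicGeometry.Motives (IsSmoothProjective ComplexPoints)

namespace Literature.AlgebraicGeometry.HodgeTheory

variable {m n d e : ℕ} {W X : Motives.SchemeOver ℂ}

/-! ### §1 Classes dominated by varieties satisfying `C` -/

/-- **The Künneth components of an algebraic class are algebraic when `C` holds for the smooth projective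
varieties of the dimension of its cycles.** Let `W`, `X` be smooth projective of dimensions `m`, `n`,
`d + e = m + n`, `m ≤ d`, and suppose that for EVERY smooth projective `V` of dimension `d` every Künneth
component of every Künneth decomposition of `cl(Δ_V)` is algebraic. Then for every algebraic class
`γ ∈ Nᵉ H^{2e}((W ⊗ X)(ℂ); ℂ)` and every Künneth decomposition `γ = Σ ρ i`, `ρ i ∈ H^{2e−i}(W) ⊗ Hⁱ(X)`,
every `ρ i` is algebraic. Proof: `γ` is a linear combination of push–pull classes `(h ≫ pr_W, h ≫ pr_X)_* 1_V`
(`algebraicClasses_eq_span_complexGysin_one`), whose Künneth components are algebraic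
(`kunnethComponent_pushPullClass_mem_algebraicClasses_of_forall`), and Künneth components are unique,
hence linear in the class (`eq_of_sum_kunnethPiece_eq`, `exists_sum_kunnethPiece_eq`).
[cite: Kahn2020, §6.9 Def. 6.29 and Lemma 6.30] [cite: Kleiman1968AlgebraicCycles, §2]
[cite: Fulton1998, §19.1 Lemma 19.1.1 and §16.1 Prop. 16.1.1 (c)] [cite: Deligne2000, §2 Remark (vi)] -/
theorem kunnethComponent_mem_algebraicClasses_of_forall_source (hW : IsSmoothProjective m W)
    (hX : IsSmoothProjective n X) (hde : d + e = m + n) (hmd : m ≤ d)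
    (hC : ∀ (V : Motives.SchemeOver ℂ) (hV : IsSmoothProjective d V)
      (πV : Fin (2 * d + 1) → complexBetti (V ⊗ V) (2 * d)),
      (∀ i : Fin (2 * d + 1), πV i ∈ kunnethPiece V V (show (2 * d - (i : ℕ)) + i = 2 * d by omega)) →
      ∑ i, πV i = diagonalClass hV → ∀ i, πV i ∈ algebraicClasses (V ⊗ V) d)
    {γ : complexBetti (W ⊗ X) (2 * e)} (hγ : γ ∈ algebraicClasses (W ⊗ X) e)
    {ρ : Fin (2 * e + 1) → complexBetti (W ⊗ X) (2 * e)}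
    (hρ : ∀ i : Fin (2 * e + 1), ρ i ∈ kunnethPiece W X (show (2 * e - (i : ℕ)) + i = 2 * e by omega))
    (hΓ : ∑ i, ρ i = γ) (i : Fin (2 * e + 1)) :
    ρ i ∈ algebraicClasses (W ⊗ X) e := by
  have hWX := Motives.IsSmoothProjective.tensor_holds hW hX
  rw [algebraicClasses_eq_span_complexGysin_one complexOrientationFamily e d hde hWX] at hγ
  -- the statement for all Künneth decompositions, by induction over the span
  revert ρ
  induction hγ using Submodule.span_induction with
  | mem c hc =>
    obtain ⟨V, hV, h, rfl⟩ := hc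
    intro ρ hρ hΓ
    -- `h = (h ≫ pr_W, h ≫ pr_X)`: a push–pull class
    have hh : h = lift (h ≫ fst W X) (h ≫ snd W X) := by ext <;> simp
    rw [hh] at hΓ
    exact kunnethComponent_pushPullClass_mem_algebraicClasses_of_forall hV hW hX (h ≫ fst W X)
      (h ≫ snd W X) hde hmd (hC V hV) hρ hΓ i
  | zero =>
    intro ρ hρ hΓ
    have h0 : ρ = fun _ ↦ 0 :=
      eq_of_sum_kunnethPiece_eq hW hX (2 * e) hρ (fun _ ↦ Submodule.zero_mem _)
        (by rw [hΓ, Finset.sum_const_zero])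
    rw [h0]
    exact Submodule.zero_mem _
  | add x y _ _ hx hy =>
    intro ρ hρ hΓ
    obtain ⟨ρx, hρx, hsumx⟩ := exists_sum_kunnethPiece_eq hW hX (2 * e) x
    have hy' : (ρ - ρx) i ∈ algebraicClasses (W ⊗ X) e :=
      hy (fun j ↦ Submodule.sub_mem _ (hρ j) (hρx j))
        (by rw [Pi.sub_def, Finset.sum_sub_distrib, hΓ, hsumx, add_sub_cancel_left])
    have hx' : ρx i ∈ algebraicClasses (W ⊗ X) e := hx hρx hsumx
    rw [show ρ i = ρx i + (ρ - ρx) i by simp]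
    exact Submodule.add_mem _ hx' hy'
  | smul c x _ hx =>
    intro ρ hρ hΓ
    by_cases hc : c = 0
    · subst hc
      rw [zero_smul] at hΓ
      have h0 : ρ = fun _ ↦ 0 :=
        eq_of_sum_kunnethPiece_eq hW hX (2 * e) hρ (fun _ ↦ Submodule.zero_mem _)
          (by rw [hΓ, Finset.sum_const_zero])
      rw [h0]
      exact Submodule.zero_mem _
    · have hx' : (c⁻¹ • ρ) i ∈ algebraicClasses (W ⊗ X) e :=
        hx (fun j ↦ Submodule.smul_mem _ _ (hρ j))
          (by rw [Pi.smul_def, ← Finset.smul_sum, hΓ, smul_smul, inv_mul_cancel₀ hc, one_smul])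
      rw [show ρ i = c • (c⁻¹ • ρ) i by
        rw [Pi.smul_apply, smul_smul, mul_inv_cancel₀ hc, one_smul]]
      exact Submodule.smul_mem _ _ hx'

/-! ### §2 Unconditional cases: cycles of dimension `≤ 2` -/

/-- **The Künneth components of an algebraic class of CYCLE DIMENSION `≤ 2` are algebraic**, unconditionally:
`d = dim W + dim X − e ≤ 2` and `dim W ≤ d`; `C` holds in dimension `≤ 2`
(`kunnethComponent_diagonalClass_mem_algebraicClasses_of_le_two`). [cite: Kahn2020, §6.9 Lemma 6.30 and Theorem 6.31 (1)–(2)]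
[cite: Voisin2025, §3.2.1 Cor. 3.9] -/
theorem kunnethComponent_mem_algebraicClasses_of_le_two (hW : IsSmoothProjective m W)
    (hX : IsSmoothProjective n X) (hde : d + e = m + n) (hmd : m ≤ d) (hd : d ≤ 2)
    {γ : complexBetti (W ⊗ X) (2 * e)} (hγ : γ ∈ algebraicClasses (W ⊗ X) e)
    {ρ : Fin (2 * e + 1) → complexBetti (W ⊗ X) (2 * e)}
    (hρ : ∀ i : Fin (2 * e + 1), ρ i ∈ kunnethPiece W X (show (2 * e - (i : ℕ)) + i = 2 * e by omega))
    (hΓ : ∑ i, ρ i = γ) (i : Fin (2 * e + 1)) :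
    ρ i ∈ algebraicClasses (W ⊗ X) e :=
  kunnethComponent_mem_algebraicClasses_of_forall_source hW hX hde hmd
    (fun _ hV _ hπV hΔV j ↦ kunnethComponent_diagonalClass_mem_algebraicClasses_of_le_two hV hd hπV hΔV j)
    hγ hρ hΓ i

/-- **Every algebraic class of `H⁴((S ⊗ S')(ℂ); ℂ)`, for smooth projective SURFACES `S`, `S'`, has algebraic
Künneth components** (the degree-`0` correspondences between surfaces, e.g. the classes of `S × S'`
decomposing under `H⁴ = ⊕ H^{4−i}(S) ⊗ Hⁱ(S')`; the components in `H²(S) ⊗ H²(S')` included) —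
unconditionally. [cite: Kahn2020, §6.9 Lemma 6.30 and Theorem 6.31 (2)] [cite: Voisin2025, §3.2.1 Cor. 3.9] -/
theorem kunnethComponent_mem_algebraicClasses_surfaces {S S' : Motives.SchemeOver ℂ}
    (hS : IsSmoothProjective 2 S) (hS' : IsSmoothProjective 2 S')
    {γ : complexBetti (S ⊗ S') (2 * 2)} (hγ : γ ∈ algebraicClasses (S ⊗ S') 2)
    {ρ : Fin (2 * 2 + 1) → complexBetti (S ⊗ S') (2 * 2)}
    (hρ : ∀ i : Fin (2 * 2 + 1), ρ i ∈ kunnethPiece S S' (show (2 * 2 - (i : ℕ)) + i = 2 * 2 by omega))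
    (hΓ : ∑ i, ρ i = γ) (i : Fin (2 * 2 + 1)) :
    ρ i ∈ algebraicClasses (S ⊗ S') 2 :=
  kunnethComponent_mem_algebraicClasses_of_le_two (d := 2) hS hS' rfl le_rfl le_rfl hγ hρ hΓ i

/-- **Every algebraic class of `H²((C ⊗ C')(ℂ); ℂ)` for smooth projective CURVES `C`, `C'` has algebraic
Künneth components** (divisor classes on a product of curves). [cite: Kahn2020, §6.9 Lemma 6.30 and Theorem 6.31 (1)] -/
theorem kunnethComponent_mem_algebraicClasses_curves {C C' : Motives.SchemeOver ℂ}
    (hC : IsSmoothProjective 1 C) (hC' : IsSmoothProjective 1 C')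
    {γ : complexBetti (C ⊗ C') (2 * 1)} (hγ : γ ∈ algebraicClasses (C ⊗ C') 1)
    {ρ : Fin (2 * 1 + 1) → complexBetti (C ⊗ C') (2 * 1)}
    (hρ : ∀ i : Fin (2 * 1 + 1), ρ i ∈ kunnethPiece C C' (show (2 * 1 - (i : ℕ)) + i = 2 * 1 by omega))
    (hΓ : ∑ i, ρ i = γ) (i : Fin (2 * 1 + 1)) :
    ρ i ∈ algebraicClasses (C ⊗ C') 1 :=
  kunnethComponent_mem_algebraicClasses_of_le_two (d := 1) hC hC' rfl le_rfl (by omega) hγ hρ hΓ i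

/-- **Algebraic classes of `H^{2e}((C ⊗ S)(ℂ); ℂ)`, `e = 1, 2`, for a curve `C` and a surface `S` have
algebraic Künneth components** (cycle dimension `3 − e ≤ 2`). [cite: Kahn2020, §6.9 Lemma 6.30 and Theorem 6.31 (1)–(2)] -/
theorem kunnethComponent_mem_algebraicClasses_curve_surface {C S : Motives.SchemeOver ℂ}
    (hC : IsSmoothProjective 1 C) (hS : IsSmoothProjective 2 S) (he : 1 ≤ e) (he' : e ≤ 2)
    {γ : complexBetti (C ⊗ S) (2 * e)} (hγ : γ ∈ algebraicClasses (C ⊗ S) e)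
    {ρ : Fin (2 * e + 1) → complexBetti (C ⊗ S) (2 * e)}
    (hρ : ∀ i : Fin (2 * e + 1), ρ i ∈ kunnethPiece C S (show (2 * e - (i : ℕ)) + i = 2 * e by omega))
    (hΓ : ∑ i, ρ i = γ) (i : Fin (2 * e + 1)) :
    ρ i ∈ algebraicClasses (C ⊗ S) e :=
  kunnethComponent_mem_algebraicClasses_of_le_two (d := 3 - e) hC hS (by omega) (by omega) (by omega)
    hγ hρ hΓ i

/-- **Algebraic classes of `H²((S ⊗ C)(ℂ); ℂ)` for a surface `S` and a curve `C` have algebraic Künneth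
components** (divisors on `S × C`). [cite: Kahn2020, §6.9 Lemma 6.30 and Theorem 6.31 (1)–(2)] -/
theorem kunnethComponent_mem_algebraicClasses_surface_curve {S C : Motives.SchemeOver ℂ}
    (hS : IsSmoothProjective 2 S) (hC : IsSmoothProjective 1 C)
    {γ : complexBetti (S ⊗ C) (2 * 1)} (hγ : γ ∈ algebraicClasses (S ⊗ C) 1)
    {ρ : Fin (2 * 1 + 1) → complexBetti (S ⊗ C) (2 * 1)}
    (hρ : ∀ i : Fin (2 * 1 + 1), ρ i ∈ kunnethPiece S C (show (2 * 1 - (i : ℕ)) + i = 2 * 1 by omega))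
    (hΓ : ∑ i, ρ i = γ) (i : Fin (2 * 1 + 1)) :
    ρ i ∈ algebraicClasses (S ⊗ C) 1 :=
  kunnethComponent_mem_algebraicClasses_of_le_two (d := 2) hS hC rfl le_rfl le_rfl hγ hρ hΓ i

/-! ### §3 Explicit families of dominating varieties -/

/-- **Linearity.** If every class of a set `T ⊆ H^{2e}((W ⊗ X)(ℂ); ℂ)` has all the Künneth components of all
its Künneth decompositions algebraic, then so does every class of the span of `T` (Künneth decompositions
exist and are unique, `exists_sum_kunnethPiece_eq`, `eq_of_sum_kunnethPiece_eq`, so "the `i`-th Künneth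
component" is linear in the class). [cite: VoisinHodgeI2002, §11.3.3 p. 286] [cite: Voisin2025, §3.2.1 (12)–(14)] -/
theorem kunnethComponent_mem_algebraicClasses_of_mem_span (hW : IsSmoothProjective m W)
    (hX : IsSmoothProjective n X) {T : Set (complexBetti (W ⊗ X) (2 * e))}
    (hT : ∀ t ∈ T, ∀ (ρ : Fin (2 * e + 1) → complexBetti (W ⊗ X) (2 * e)),
      (∀ i : Fin (2 * e + 1), ρ i ∈ kunnethPiece W X (show (2 * e - (i : ℕ)) + i = 2 * e by omega)) →
      ∑ i, ρ i = t → ∀ i, ρ i ∈ algebraicClasses (W ⊗ X) e)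
    {γ : complexBetti (W ⊗ X) (2 * e)} (hγ : γ ∈ Submodule.span ℂ T)
    {ρ : Fin (2 * e + 1) → complexBetti (W ⊗ X) (2 * e)}
    (hρ : ∀ i : Fin (2 * e + 1), ρ i ∈ kunnethPiece W X (show (2 * e - (i : ℕ)) + i = 2 * e by omega))
    (hΓ : ∑ i, ρ i = γ) (i : Fin (2 * e + 1)) :
    ρ i ∈ algebraicClasses (W ⊗ X) e := by
  revert ρ
  induction hγ using Submodule.span_induction with
  | mem c hc =>
    intro ρ hρ hΓ
    exact hT c hc ρ hρ hΓ i
  | zero =>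
    intro ρ hρ hΓ
    have h0 : ρ = fun _ ↦ 0 :=
      eq_of_sum_kunnethPiece_eq hW hX (2 * e) hρ (fun _ ↦ Submodule.zero_mem _)
        (by rw [hΓ, Finset.sum_const_zero])
    rw [h0]
    exact Submodule.zero_mem _
  | add x y _ _ hx hy =>
    intro ρ hρ hΓ
    obtain ⟨ρx, hρx, hsumx⟩ := exists_sum_kunnethPiece_eq hW hX (2 * e) x
    have hy' : (ρ - ρx) i ∈ algebraicClasses (W ⊗ X) e :=
      hy (fun j ↦ Submodule.sub_mem _ (hρ j) (hρx j))
        (by rw [Pi.sub_def, Finset.sum_sub_distrib, hΓ, hsumx, add_sub_cancel_left])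
    have hx' : ρx i ∈ algebraicClasses (W ⊗ X) e := hx hρx hsumx
    rw [show ρ i = ρx i + (ρ - ρx) i by simp]
    exact Submodule.add_mem _ hx' hy'
  | smul c x _ hx =>
    intro ρ hρ hΓ
    by_cases hc : c = 0
    · subst hc
      rw [zero_smul] at hΓ
      have h0 : ρ = fun _ ↦ 0 :=
        eq_of_sum_kunnethPiece_eq hW hX (2 * e) hρ (fun _ ↦ Submodule.zero_mem _)
          (by rw [hΓ, Finset.sum_const_zero])
      rw [h0]
      exact Submodule.zero_mem _
    · have hx' : (c⁻¹ • ρ) i ∈ algebraicClasses (W ⊗ X) e :=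
        hx (fun j ↦ Submodule.smul_mem _ _ (hρ j))
          (by rw [Pi.smul_def, ← Finset.smul_sum, hΓ, smul_smul, inv_mul_cancel₀ hc, one_smul])
      rw [show ρ i = c • (c⁻¹ • ρ) i by
        rw [Pi.smul_apply, smul_smul, mul_inv_cancel₀ hc, one_smul]]
      exact Submodule.smul_mem _ _ hx'

/-- **A class whose cycles are dominated by varieties satisfying `C` has algebraic Künneth components**: if
`γ = Σⱼ aⱼ · (hⱼ)_* 1_{Vⱼ} ∈ H^{2e}((W ⊗ X)(ℂ); ℂ)` for morphisms `hⱼ : Vⱼ ⟶ W ⊗ X` from smooth projective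
`d`-folds `Vⱼ` (`d + e = dim W + dim X`, `dim W ≤ d`) each of which satisfies `C`, then every Künneth component
of every Künneth decomposition of `γ` is algebraic (`(hⱼ)_* 1 = (hⱼ ≫ pr_W, hⱼ ≫ pr_X)_* 1` is a push–pull
class, `kunnethComponent_pushPullClass_mem_algebraicClasses_of_forall`, and §3 linearity).
[cite: Kahn2020, §6.9 Def. 6.29 and Lemma 6.30] [cite: Kleiman1968AlgebraicCycles, §2]
[cite: Fulton1998, §16.1 Prop. 16.1.1 (c)] -/
theorem kunnethComponent_mem_algebraicClasses_of_eq_sum_complexGysin_one (hW : IsSmoothProjective m W)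
    (hX : IsSmoothProjective n X) (hde : d + e = m + n) (hmd : m ≤ d) {ι : Type} [Fintype ι]
    {V : ι → Motives.SchemeOver ℂ} (hV : ∀ j, IsSmoothProjective d (V j)) (h : ∀ j, V j ⟶ W ⊗ X)
    (a : ι → ℂ)
    (hC : ∀ (j : ι) (πV : Fin (2 * d + 1) → complexBetti (V j ⊗ V j) (2 * d)),
      (∀ i : Fin (2 * d + 1), πV i ∈ kunnethPiece (V j) (V j) (show (2 * d - (i : ℕ)) + i = 2 * d by omega)) →
      ∑ i, πV i = diagonalClass (hV j) → ∀ i, πV i ∈ algebraicClasses (V j ⊗ V j) d)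
    {ρ : Fin (2 * e + 1) → complexBetti (W ⊗ X) (2 * e)}
    (hρ : ∀ i : Fin (2 * e + 1), ρ i ∈ kunnethPiece W X (show (2 * e - (i : ℕ)) + i = 2 * e by omega))
    (hΓ : ∑ i, ρ i = ∑ j, a j • complexGysin complexOrientationFamily (hV j)
      (Motives.IsSmoothProjective.tensor_holds hW hX) (h j) (show 0 + 2 * (m + n) = 2 * e + 2 * d by omega)
      (singularCohomology.one ℂ (ComplexPoints (V j))))
    (i : Fin (2 * e + 1)) :
    ρ i ∈ algebraicClasses (W ⊗ X) e := by
  have hmem : (∑ j, a j • complexGysin complexOrientationFamily (hV j)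
      (Motives.IsSmoothProjective.tensor_holds hW hX) (h j) (show 0 + 2 * (m + n) = 2 * e + 2 * d by omega)
      (singularCohomology.one ℂ (ComplexPoints (V j)))) ∈
      Submodule.span ℂ (Set.range fun j ↦ complexGysin complexOrientationFamily (hV j)
        (Motives.IsSmoothProjective.tensor_holds hW hX) (h j) (show 0 + 2 * (m + n) = 2 * e + 2 * d by omega)
        (singularCohomology.one ℂ (ComplexPoints (V j)))) :=
    Submodule.sum_mem _ fun j _ ↦ Submodule.smul_mem _ _ (Submodule.subset_span (Set.mem_range_self j))
  refine kunnethComponent_mem_algebraicClasses_of_mem_span hW hX ?_ hmem hρ hΓ i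
  rintro _ ⟨j, rfl⟩ ρ' hρ' hΓ'
  dsimp only at hΓ'
  have hh : h j = lift (h j ≫ fst W X) (h j ≫ snd W X) := by ext <;> simp
  rw [hh] at hΓ'
  exact kunnethComponent_pushPullClass_mem_algebraicClasses_of_forall (hV j) hW hX (h j ≫ fst W X)
    (h j ≫ snd W X) hde hmd (hC j) hρ' hΓ'

/-- **Cycles dominated by abelian varieties**: a class `γ = Σⱼ aⱼ · (hⱼ)_* 1 ∈ H^{2e}((W ⊗ X)(ℂ); ℂ)` with
`hⱼ : Aⱼ ⟶ W ⊗ X` from complex abelian varieties `Aⱼ` of dimension `d` (`d + e = dim W + dim X`, `dim W ≤ d`)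
has algebraic Künneth components — `C(A)` is the tree's
`AbelianVariety.kunnethComponent_diagonalClass_mem_algebraicClasses` (Lieberman–Kleiman).
[cite: Kahn2020, §6.9 Lemma 6.30 and Theorem 6.31 (3)] [cite: Kleiman1968AlgebraicCycles, §2 Appendix (2A11)] -/
theorem kunnethComponent_mem_algebraicClasses_of_eq_sum_complexGysin_one_abelianVariety
    (hW : IsSmoothProjective m W) (hX : IsSmoothProjective n X) (hde : d + e = m + n) (hmd : m ≤ d)
    {ι : Type} [Fintype ι] (A : ι → Motives.AbelianVariety ℂ) (hA : ∀ j, (A j).dim = d)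
    (h : ∀ j, (A j).X ⟶ W ⊗ X) (a : ι → ℂ)
    {ρ : Fin (2 * e + 1) → complexBetti (W ⊗ X) (2 * e)}
    (hρ : ∀ i : Fin (2 * e + 1), ρ i ∈ kunnethPiece W X (show (2 * e - (i : ℕ)) + i = 2 * e by omega))
    (hΓ : ∑ i, ρ i = ∑ j, a j • complexGysin complexOrientationFamily
      ((hA j) ▸ Motives.AbelianVariety.isSmoothProjective_holds (A := A j))
      (Motives.IsSmoothProjective.tensor_holds hW hX) (h j) (show 0 + 2 * (m + n) = 2 * e + 2 * d by omega)
      (singularCohomology.one ℂ (ComplexPoints (A j).X)))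
    (i : Fin (2 * e + 1)) :
    ρ i ∈ algebraicClasses (W ⊗ X) e := by
  refine kunnethComponent_mem_algebraicClasses_of_eq_sum_complexGysin_one hW hX hde hmd
    (fun j ↦ (hA j) ▸ Motives.AbelianVariety.isSmoothProjective_holds (A := A j)) h a
    (fun j πV hπV hΔV k ↦ ?_) hρ hΓ i
  -- `C(A j)`, transported along `(A j).dim = d`
  have key : ∀ (d' : ℕ) (hd' : (A j).dim = d') (hV' : IsSmoothProjective d' (A j).X)
      (π' : Fin (2 * d' + 1) → complexBetti ((A j).X ⊗ (A j).X) (2 * d'))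
      (_ : ∀ i : Fin (2 * d' + 1), π' i ∈ kunnethPiece (A j).X (A j).X
        (show (2 * d' - (i : ℕ)) + i = 2 * d' by omega))
      (_ : ∑ i, π' i = diagonalClass hV') (k' : Fin (2 * d' + 1)),
      π' k' ∈ algebraicClasses ((A j).X ⊗ (A j).X) d' := by
    intro d' hd' hV' π' hπ' hΔ' k'
    subst hd'
    exact (A j).kunnethComponent_diagonalClass_mem_algebraicClasses hπ' hΔ' k'
  exact key d (hA j) _ πV hπV hΔV k

/-- **Cycles dominated by products of varieties of dimension `≤ 2`**: a class
`γ = Σⱼ aⱼ · (hⱼ)_* 1 ∈ H^{2e}((W ⊗ X)(ℂ); ℂ)` with `hⱼ : Pⱼ ⊗ Qⱼ ⟶ W ⊗ X`, `dim Pⱼ = p ≤ 2`, `dim Qⱼ = q ≤ 2`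
(`p + q + e = dim W + dim X`, `dim W ≤ p + q`; e.g. cycles of dimension `3` dominated by products `C × S` of a
curve and a surface, of dimension `4` dominated by `S × S'`) has algebraic Künneth components — `C(P × Q)` is the
tree's `kunnethComponent_diagonalClass_mem_algebraicClasses_tensor_of_le_two`.
[cite: Kahn2020, §6.9 Lemma 6.30 (2)–(3) and Theorem 6.31 (1)–(2)] [cite: Kleiman1968AlgebraicCycles, §2] -/
theorem kunnethComponent_mem_algebraicClasses_of_eq_sum_complexGysin_one_tensor_of_le_two {p q : ℕ}
    (hW : IsSmoothProjective m W) (hX : IsSmoothProjective n X) (hde : (p + q) + e = m + n) (hmd : m ≤ p + q)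
    (hp : p ≤ 2) (hq : q ≤ 2) {ι : Type} [Fintype ι] {P Q : ι → Motives.SchemeOver ℂ}
    (hP : ∀ j, IsSmoothProjective p (P j)) (hQ : ∀ j, IsSmoothProjective q (Q j))
    (h : ∀ j, P j ⊗ Q j ⟶ W ⊗ X) (a : ι → ℂ)
    {ρ : Fin (2 * e + 1) → complexBetti (W ⊗ X) (2 * e)}
    (hρ : ∀ i : Fin (2 * e + 1), ρ i ∈ kunnethPiece W X (show (2 * e - (i : ℕ)) + i = 2 * e by omega))
    (hΓ : ∑ i, ρ i = ∑ j, a j • complexGysin complexOrientationFamily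
      (Motives.IsSmoothProjective.tensor_holds (hP j) (hQ j))
      (Motives.IsSmoothProjective.tensor_holds hW hX) (h j)
      (show 0 + 2 * (m + n) = 2 * e + 2 * (p + q) by omega)
      (singularCohomology.one ℂ (ComplexPoints (P j ⊗ Q j))))
    (i : Fin (2 * e + 1)) :
    ρ i ∈ algebraicClasses (W ⊗ X) e :=
  kunnethComponent_mem_algebraicClasses_of_eq_sum_complexGysin_one hW hX hde hmd
    (fun j ↦ Motives.IsSmoothProjective.tensor_holds (hP j) (hQ j)) h a
    (fun j _ hπV hΔV k ↦
      kunnethComponent_diagonalClass_mem_algebraicClasses_tensor_of_le_two (hP j) (hQ j) hp hq hπV hΔV k)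
    hρ hΓ i

end Literature.AlgebraicGeometry.HodgeTheory

end
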